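import Literature.MathematicalPhysics.KineticTheory.RoughSphereFlow
import HarnessLib

/-!
# The rough-sphere flow: the routes' inline `let` block equals the library names

Definition item `defn-RoughSphereFlow-2` (topic `Literature/MathematicalPhysics/KineticTheory`),
wanted by route `BryanRoughSphereDial` of `AtomisticToContinuum/HydrodynamicLimit` (and verbatim the
same block in the retired route `RoughSpheresKappaDial`). The named objects the request asks for —
`roughPair κ`, `roughStep`, `roughStateAfter`, `roughInstant`, `roughFlow`, `spinLaw`, `roughInit`
and the empirical collision / spin statistics `roughCollisionMeasure`, `roughCollisionLaw`,
`roughCollisionsOf`, `roughFeedback`, `roughEmpiricalMeasure`, `empiricalRotEnergyField`,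
`spinMaxwellian` — are the content of `RoughSphereFlow.lean` (item `defn-RoughSphereFlow`).

The six typed statement items of the route (`KappaSwapGap`, `VanishingKappaEuler`,
`SmallKappaAccuracy`, `RoughEulerFixedKappa`, `RoughWellPosed`, `KappaZeroReduction`) are stated
with that block **inlined** as a `let` telescope
`let Cfg …; let Spin …; let G …; let ε …; let τ …; let S …; let rpair …; let rstep …; let rstate …;
let rinst …; let rflow …; let spinLaw …; let init …; …`. This file is the machine-checked form of
"the library names are verbatim that block": `roughPair_inline` identifies the inline rule, as the
closed lambda in which it occurs once the telescope is expanded, with `roughPair`; every other lemma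
states, *inside the very same `let` telescope* (copied token for token), that the inline object
equals the library one — `rstep = roughStep`, `rstate = roughStateAfter`, `rinst = roughInstant`,
`rflow = roughFlow`, `spinLaw = spinLaw`, `init = roughInit`. Only the rule needs algebra (`J` is
written `-(g·k)k - κ(1+κ)⁻¹gₜ - √κ(1+κ)⁻¹ k×S` inline and `… + roughSpinImpulse κ n S` in the
library, and the spin kick carries `1/(1+κ)` inline versus `(1+κ)⁻¹`: `sub_eq_add_neg`, `one_div`);
given that, everything else is *definitionally* the library's `Carrying.*` recursion (the proofs
are `rfl` after rewriting the rule).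

## How a prover uses it

Introducing the outer binders of such an item (`intro σ N p t`, or applying a hypothesis
`h : KappaSwapGap` to its first arguments) zeta-expands the telescope, after which the inline
objects occur as closed lambdas applied to arguments, e.g. `(fun κ σ N p t => …) 0 σ N p t`. Then

  `rw [roughFlow_inline, roughInit_inline, spinLaw_inline]` (`at h`), then `beta_reduce` (`at h`)

turns the statement into library language (`roughFlow (r * (N+1)^(-1/3)) σ N (roughInit θ₀ p) t`,
`(P N).prod (spinLaw N)`, …), where the API of `RoughSphereFlow.lean` applies; e.g.
`KappaZeroReduction` is then `fst_roughFlow_zero σ N p t`. (`rw` matches the left-hand sides up to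
syntactic/reducible unfolding, which is why they are kept literally in the route's form; do not
`dsimp`/`simp` the goal *before* rewriting, as that β-reduces the lambdas away.)

## References

* S. Chapman, T. G. Cowling, *The Mathematical Theory of Non-uniform Gases*, 3rd ed., CUP 1970,
  §11.2, eqs. (11.2,7)–(11.2,10) (the rule inlined as `rpair`).
* C. Cercignani, R. Illner, M. Pulvirenti, *The Mathematical Theory of Dilute Gases*, Springer
  1994, App. 4.A (the collision-by-collision construction inlined as `rstep … rflow`).
-/

noncomputable section

open MeasureTheory ProbabilityTheory Function Set
open Literature.Analysis.FluidPDE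
open scoped ENNReal InnerProductSpace

namespace Literature.MathematicalPhysics.KineticTheory

/-- The route's inline collision rule, as the closed lambda
`fun κ _ i j p => (…Bryan's rule, Chapman–Cowling (11.2,7)–(11.2,10)…)` in which it occurs in the
zeta-expanded items, is `roughPair`: `J = -(g·k)k - κ(1+κ)⁻¹ gₜ - √κ(1+κ)⁻¹ k × S` is
`roughImpulse` (`sub_eq_add_neg`) and `√κ(1+κ)⁻¹ k × gₜ + (1/(1+κ)) k × (k × S)` is `roughSpinKick`
(`one_div`). [cite: ChapmanCowling1970, §11.2 eqs. 7–10] -/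
theorem roughPair_inline :
    (fun (κ : ℝ) (x : ℕ) (i j : Fin (x + 1))
        (p : Config (x + 1) (Fin 3) T3 × (Fin (x + 1) → V3)) =>
      let z := p.1; let s := p.2; let n := (Torus.geometry (Fin 3)).sepVec (z i).1 (z j).1
      let k := ‖n‖⁻¹ • n; let g := (z i).2 - (z j).2; let gt := g - (⟪g, k⟫_ℝ) • k
      let S2 := s i + s j
      let J := -((⟪g, k⟫_ℝ) • k) - (κ / (1 + κ)) • gt - (Real.sqrt κ / (1 + κ)) • cross k S2
      let ds := (Real.sqrt κ / (1 + κ)) • cross k gt + (1 / (1 + κ)) • cross k (cross k S2)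
      (Function.update (Function.update z i ((z i).1, (z i).2 + J)) j ((z j).1, (z j).2 - J),
        Function.update (Function.update s i (s i + ds)) j (s j + ds))) =
      fun (κ : ℝ) (x : ℕ) (i j : Fin (x + 1)) => roughPair κ i j := by
  funext κ x i j p
  simp only [roughPair, RoughSphere.pair, roughImpulse, roughSpinKick, roughSpinImpulse, one_div,
    sub_eq_add_neg]

open scoped Classical in
/-- Inside the route's `let` telescope (verbatim `Cfg, …, rstep`): the inline collision step —
free flight to `Alexander.freeExitTime`, then the rule on the incoming contact pair — is
`roughStep` (`= Carrying.step _ _ (roughPair κ)`). [cite: CIP1994, App. 4.A p. 111] -/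
theorem roughStep_inline :
    let Cfg : ℕ → Type := fun N => Config (N + 1) (Fin 3) T3
    let Spin : ℕ → Type := fun N => Fin (N + 1) → V3
    let G := Torus.geometry (Fin 3)
    let ε : ℝ → ℕ → ℝ := hsDiameter
    let τ : ℝ → (N : ℕ) → Cfg N → ENNReal := fun σ N z => Alexander.freeExitTime G (ε σ N) z
    let S : ℝ → (N : ℕ) → Cfg N → Cfg N := fun t _ z => freeFlight G t z
    let rpair : ℝ → (N : ℕ) → Fin (N + 1) → Fin (N + 1) → Cfg N × Spin N → Cfg N × Spin N :=
      fun κ _ i j p =>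
        let z := p.1; let s := p.2; let n := G.sepVec (z i).1 (z j).1; let k := ‖n‖⁻¹ • n
        let g := (z i).2 - (z j).2; let gt := g - (⟪g, k⟫_ℝ) • k; let S2 := s i + s j
        let J := -((⟪g, k⟫_ℝ) • k) - (κ / (1 + κ)) • gt - (Real.sqrt κ / (1 + κ)) • cross k S2
        let ds := (Real.sqrt κ / (1 + κ)) • cross k gt + (1 / (1 + κ)) • cross k (cross k S2)
        (Function.update (Function.update z i ((z i).1, (z i).2 + J)) j ((z j).1, (z j).2 - J),
          Function.update (Function.update s i (s i + ds)) j (s j + ds))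
    let rstep : ℝ → ℝ → (N : ℕ) → Cfg N × Spin N → Cfg N × Spin N := fun κ σ N p =>
      let z' := S (τ σ N p.1).toReal N p.1
      if τ σ N p.1 = ⊤ then p
      else if h : (Alexander.incomingPairs G (ε σ N) z').Nonempty then
        rpair κ N h.some.1 h.some.2 (z', p.2) else (z', p.2)
    rstep = fun (κ σ : ℝ) (N : ℕ) (p : Cfg N × Spin N) => roughStep κ σ N p := by
  intro Cfg Spin G ε τ S rpair rstep
  have key : ∀ (κ σ : ℝ) (N : ℕ) (p : Cfg N × Spin N),
      rstep κ σ N p = Carrying.step G (ε σ N) (rpair κ N) p := fun _ _ _ _ => rfl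
  funext κ σ N p
  rw [key, show rpair = fun (κ : ℝ) (x : ℕ) (i j : Fin (x + 1)) => roughPair κ i j from
    roughPair_inline]

open scoped Classical in
/-- Inside the route's `let` telescope (verbatim `Cfg, …, rstate`): the inline post-collisional
states `(rstep κ σ N)^[k] p` are `roughStateAfter`. [cite: CIP1994, App. 4.A p. 109] -/
theorem roughStateAfter_inline :
    let Cfg : ℕ → Type := fun N => Config (N + 1) (Fin 3) T3
    let Spin : ℕ → Type := fun N => Fin (N + 1) → V3
    let G := Torus.geometry (Fin 3)
    let ε : ℝ → ℕ → ℝ := hsDiameter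
    let τ : ℝ → (N : ℕ) → Cfg N → ENNReal := fun σ N z => Alexander.freeExitTime G (ε σ N) z
    let S : ℝ → (N : ℕ) → Cfg N → Cfg N := fun t _ z => freeFlight G t z
    let rpair : ℝ → (N : ℕ) → Fin (N + 1) → Fin (N + 1) → Cfg N × Spin N → Cfg N × Spin N :=
      fun κ _ i j p =>
        let z := p.1; let s := p.2; let n := G.sepVec (z i).1 (z j).1; let k := ‖n‖⁻¹ • n
        let g := (z i).2 - (z j).2; let gt := g - (⟪g, k⟫_ℝ) • k; let S2 := s i + s j
        let J := -((⟪g, k⟫_ℝ) • k) - (κ / (1 + κ)) • gt - (Real.sqrt κ / (1 + κ)) • cross k S2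
        let ds := (Real.sqrt κ / (1 + κ)) • cross k gt + (1 / (1 + κ)) • cross k (cross k S2)
        (Function.update (Function.update z i ((z i).1, (z i).2 + J)) j ((z j).1, (z j).2 - J),
          Function.update (Function.update s i (s i + ds)) j (s j + ds))
    let rstep : ℝ → ℝ → (N : ℕ) → Cfg N × Spin N → Cfg N × Spin N := fun κ σ N p =>
      let z' := S (τ σ N p.1).toReal N p.1
      if τ σ N p.1 = ⊤ then p
      else if h : (Alexander.incomingPairs G (ε σ N) z').Nonempty then
        rpair κ N h.some.1 h.some.2 (z', p.2) else (z', p.2)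
    let rstate : ℝ → ℝ → (N : ℕ) → Cfg N × Spin N → ℕ → Cfg N × Spin N := fun κ σ N p k =>
      (rstep κ σ N)^[k] p
    rstate = fun (κ σ : ℝ) (N : ℕ) (p : Cfg N × Spin N) (k : ℕ) => roughStateAfter κ σ N p k := by
  intro Cfg Spin G ε τ S rpair rstep rstate
  have key : ∀ (κ σ : ℝ) (N : ℕ) (p : Cfg N × Spin N) (k : ℕ),
      rstate κ σ N p k = Carrying.stateAfter G (ε σ N) (rpair κ N) p k := fun _ _ _ _ _ => rfl
  funext κ σ N p k
  rw [key, show rpair = fun (κ : ℝ) (x : ℕ) (i j : Fin (x + 1)) => roughPair κ i j from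
    roughPair_inline]

open scoped Classical in
/-- Inside the route's `let` telescope (verbatim `Cfg, …, rinst`): the inline collision instants
`∑_{m<k} τ(z_m)` are `roughInstant`. [cite: CIP1994, App. 4.A p. 109] -/
theorem roughInstant_inline :
    let Cfg : ℕ → Type := fun N => Config (N + 1) (Fin 3) T3
    let Spin : ℕ → Type := fun N => Fin (N + 1) → V3
    let G := Torus.geometry (Fin 3)
    let ε : ℝ → ℕ → ℝ := hsDiameter
    let τ : ℝ → (N : ℕ) → Cfg N → ENNReal := fun σ N z => Alexander.freeExitTime G (ε σ N) z
    let S : ℝ → (N : ℕ) → Cfg N → Cfg N := fun t _ z => freeFlight G t z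
    let rpair : ℝ → (N : ℕ) → Fin (N + 1) → Fin (N + 1) → Cfg N × Spin N → Cfg N × Spin N :=
      fun κ _ i j p =>
        let z := p.1; let s := p.2; let n := G.sepVec (z i).1 (z j).1; let k := ‖n‖⁻¹ • n
        let g := (z i).2 - (z j).2; let gt := g - (⟪g, k⟫_ℝ) • k; let S2 := s i + s j
        let J := -((⟪g, k⟫_ℝ) • k) - (κ / (1 + κ)) • gt - (Real.sqrt κ / (1 + κ)) • cross k S2
        let ds := (Real.sqrt κ / (1 + κ)) • cross k gt + (1 / (1 + κ)) • cross k (cross k S2)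
        (Function.update (Function.update z i ((z i).1, (z i).2 + J)) j ((z j).1, (z j).2 - J),
          Function.update (Function.update s i (s i + ds)) j (s j + ds))
    let rstep : ℝ → ℝ → (N : ℕ) → Cfg N × Spin N → Cfg N × Spin N := fun κ σ N p =>
      let z' := S (τ σ N p.1).toReal N p.1
      if τ σ N p.1 = ⊤ then p
      else if h : (Alexander.incomingPairs G (ε σ N) z').Nonempty then
        rpair κ N h.some.1 h.some.2 (z', p.2) else (z', p.2)
    let rstate : ℝ → ℝ → (N : ℕ) → Cfg N × Spin N → ℕ → Cfg N × Spin N := fun κ σ N p k =>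
      (rstep κ σ N)^[k] p
    let rinst : ℝ → ℝ → (N : ℕ) → Cfg N × Spin N → ℕ → ENNReal := fun κ σ N p k =>
      ∑ m ∈ Finset.range k, τ σ N (rstate κ σ N p m).1
    rinst = fun (κ σ : ℝ) (N : ℕ) (p : Cfg N × Spin N) (k : ℕ) => roughInstant κ σ N p k := by
  intro Cfg Spin G ε τ S rpair rstep rstate rinst
  have key : ∀ (κ σ : ℝ) (N : ℕ) (p : Cfg N × Spin N) (k : ℕ),
      rinst κ σ N p k = Carrying.instant G (ε σ N) (rpair κ N) p k := fun _ _ _ _ _ => rfl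
  funext κ σ N p k
  rw [key, show rpair = fun (κ : ℝ) (x : ℕ) (i j : Fin (x + 1)) => roughPair κ i j from
    roughPair_inline]

open scoped Classical in
/-- Inside the route's `let` telescope (verbatim `Cfg, …, rflow`, exactly as in
`BryanRoughSphereDial.KappaSwapGap`): **the inline rough-sphere flow is `roughFlow`** — free
flight of the translational part from the last post-collisional state, spins frozen, with the
collision count `sSup {k | t_k ≤ t}` (`= Carrying.flow _ _ (roughPair κ)`).
[cite: ChapmanCowling1970, §11.2] -/
theorem roughFlow_inline :
    let Cfg : ℕ → Type := fun N => Config (N + 1) (Fin 3) T3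
    let Spin : ℕ → Type := fun N => Fin (N + 1) → V3
    let G := Torus.geometry (Fin 3)
    let ε : ℝ → ℕ → ℝ := hsDiameter
    let τ : ℝ → (N : ℕ) → Cfg N → ENNReal := fun σ N z => Alexander.freeExitTime G (ε σ N) z
    let S : ℝ → (N : ℕ) → Cfg N → Cfg N := fun t _ z => freeFlight G t z
    let rpair : ℝ → (N : ℕ) → Fin (N + 1) → Fin (N + 1) → Cfg N × Spin N → Cfg N × Spin N :=
      fun κ _ i j p =>
        let z := p.1; let s := p.2; let n := G.sepVec (z i).1 (z j).1; let k := ‖n‖⁻¹ • n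
        let g := (z i).2 - (z j).2; let gt := g - (⟪g, k⟫_ℝ) • k; let S2 := s i + s j
        let J := -((⟪g, k⟫_ℝ) • k) - (κ / (1 + κ)) • gt - (Real.sqrt κ / (1 + κ)) • cross k S2
        let ds := (Real.sqrt κ / (1 + κ)) • cross k gt + (1 / (1 + κ)) • cross k (cross k S2)
        (Function.update (Function.update z i ((z i).1, (z i).2 + J)) j ((z j).1, (z j).2 - J),
          Function.update (Function.update s i (s i + ds)) j (s j + ds))
    let rstep : ℝ → ℝ → (N : ℕ) → Cfg N × Spin N → Cfg N × Spin N := fun κ σ N p =>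
      let z' := S (τ σ N p.1).toReal N p.1
      if τ σ N p.1 = ⊤ then p
      else if h : (Alexander.incomingPairs G (ε σ N) z').Nonempty then
        rpair κ N h.some.1 h.some.2 (z', p.2) else (z', p.2)
    let rstate : ℝ → ℝ → (N : ℕ) → Cfg N × Spin N → ℕ → Cfg N × Spin N := fun κ σ N p k =>
      (rstep κ σ N)^[k] p
    let rinst : ℝ → ℝ → (N : ℕ) → Cfg N × Spin N → ℕ → ENNReal := fun κ σ N p k =>
      ∑ m ∈ Finset.range k, τ σ N (rstate κ σ N p m).1
    let rflow : ℝ → ℝ → (N : ℕ) → Cfg N × Spin N → ℝ → Cfg N × Spin N := fun κ σ N p t =>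
      let K := sSup {k : ℕ | rinst κ σ N p k ≤ ENNReal.ofReal t}
      (S (t - (rinst κ σ N p K).toReal) N (rstate κ σ N p K).1, (rstate κ σ N p K).2)
    rflow = fun (κ σ : ℝ) (N : ℕ) (p : Cfg N × Spin N) (t : ℝ) => roughFlow κ σ N p t := by
  intro Cfg Spin G ε τ S rpair rstep rstate rinst rflow
  have key : ∀ (κ σ : ℝ) (N : ℕ) (p : Cfg N × Spin N) (t : ℝ),
      rflow κ σ N p t = Carrying.flow G (ε σ N) (rpair κ N) p t := fun _ _ _ _ _ => rfl
  funext κ σ N p t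
  rw [key, show rpair = fun (κ : ℝ) (x : ℕ) (i j : Fin (x + 1)) => roughPair κ i j from
    roughPair_inline]

/-- Inside the route's `let` telescope (verbatim `Spin, spinLaw`): the inline spin law
`Measure.pi` of standard Gaussians is the library's `spinLaw`. [folklore] -/
theorem spinLaw_inline :
    let Spin : ℕ → Type := fun N => Fin (N + 1) → V3
    let spinLaw : (N : ℕ) → Measure (Spin N) := fun N =>
      Measure.pi (fun _ : Fin (N + 1) => stdGaussian V3)
    spinLaw = Literature.MathematicalPhysics.KineticTheory.spinLaw := by
  intro Spin spinLaw
  rfl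

/-- Inside the route's `let` telescope (verbatim `Cfg, Spin, init`): the inline initial spins
`(z, ξ) ↦ (z, (√θ₀(xᵢ) ξᵢ)ᵢ)` are `roughInit θ₀`. [cite: ChapmanCowling1970, §11.1] -/
theorem roughInit_inline :
    let Cfg : ℕ → Type := fun N => Config (N + 1) (Fin 3) T3
    let Spin : ℕ → Type := fun N => Fin (N + 1) → V3
    let init : (T3 → ℝ) → (N : ℕ) → Cfg N × Spin N → Cfg N × Spin N := fun θ₀ _ p =>
      (p.1, fun i => Real.sqrt (θ₀ (p.1 i).1) • p.2 i)
    init = fun (θ₀ : T3 → ℝ) (N : ℕ) (p : Cfg N × Spin N) => roughInit θ₀ p := by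
  intro Cfg Spin init
  rfl

end Literature.MathematicalPhysics.KineticTheory

end
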